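import Mathlib
import HarnessLib

/-!
# Route `KLProgramme`, crux K3 `KLRegimeTwoPointLimit` (stmt-HubbardSuperconductivity-19937), child 1 `KLRegimeBetaSplit` —
# the SIGN-RESOLVED COOPER RESUMMATION IS ENTRYWISE BOUNDED: Sherman–Morrison for the repulsive s-wave rank-one part,
# Neumann series for the rest (the leaf's whole sign lever, abstract finite-carrier form)

Cell gate-hubbard-kl, seat p1 (C1 BetaSplit lead, g5).  Setting (HOME/STATUS 2026-08-26T09:21:49Z, repair (B1-v2)): a finite
carrier `S` (sector sites / shell lattice momenta) with weights `w ≥ 0` of total mass `W = Σ w` (the BCS measure of the shells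
integrated so far enters only through `B ≥ 0`, the accumulated bubble mass, and `w`), and a Cooper amplitude ARRAY

  `𝒞 = U·J + 𝒟`,  `J` the all-ones matrix (the bare on-site repulsion `U ≥ 0` is exactly s-wave, rank one in the `w`-pairing),
  `|𝒟(s,t)| ≤ δ` entrywise (everything generated at second order: `δ = O(U²)`).

The exactly resummed particle–particle ladder after bubble mass `B` is the array `(1 + B·𝒞·diag w)⁻¹·𝒞` (`= 𝒞·(1 + B·diag w·𝒞)⁻¹`,
push-through; C2's cascade `x ↦ x/(1 + b x)` composed over the shells, `cascadeStep`).  THEOREM (`klcr_resummed_entry_le`): if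
`B·W·δ ≤ 1/3` then `1 + B·𝒞·diag w` is invertible and EVERY ENTRY of the resummed array has modulus `≤ 6·(U + δ)` — uniformly in
`B ≥ 0`, although the s-wave part `B·U·W` may be arbitrarily large (in the Kohn–Luttinger regime `B ≍ c/U²`, so `B U W ≍ c/U → ∞`).
The sign `U ≥ 0` is used exactly once: the Sherman–Morrison denominator `d = 1 + B·U·⟨w, (1 + B𝒟 diag w)⁻¹ 𝟙⟩` has
`Re d ≥ 1 + B U W/2 ≥ 1`; for `U < 0` it vanishes at the s-wave BCS pole, as it must.  The `𝒟`-part is inverted by the Neumann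
series in the `ℓ^∞`-operator (max-row-sum) norm, where `‖B·𝒟·diag w‖ ≤ B·W·δ ≤ 1/3`: this is the smallness `c ≤ c₀` of the leaf
(`B_n·W·max|𝒟| ≤ c·C_D·ln 4`), below every channel's onset — no `D₄` block decomposition and no spectral envelope is needed, and
(unlike operator-norm envelopes, which bound entries only up to `1/√(w_s w_t) ≍ 4ⁿ/W`) the conclusion is ENTRYWISE, which is what the
endpoint norm line (B2) = BGM (2.71a) consumes on Cooper-class tuples.

Pure finite-dimensional linear algebra (Mathlib's `Matrix.Norms.Operator` scoped `L^∞`-operator norm, `Units.oneSub`); no model object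
is mentioned — the instantiation (`S` = lattice momenta of the scale ball, `w` = `klSectorWeight`/`bcsMeasure`, `𝒞` = `klCooperAmplitude`)
is child 1's.  References: HOME/DECOMP.md App. E (E2)/(E.4); HOME/prover-p1b/BETASPLIT-PRED.md (B1)/(B2); J. Sherman, W. J. Morrison,
Ann. Math. Statistics 21 (1950) 124; BGM 2006 §3 (3.65)–(3.67) (the sign-blind version of the same recursion).
-/

noncomputable section

namespace Summit.HubbardSuperconductivity.HubbardSuperconductivity.Theorems.KLProgrammeCooperResummation

set_option linter.dupNamespace false -- summit = problem name (single-conjunct summit), D-0017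

open scoped Matrix.Norms.Operator
open Matrix Finset

variable {S : Type*} [Fintype S] [DecidableEq S]

/-! ### The `L^∞`-operator (max-row-sum) norm: rows, entries, products -/

/-- A row's absolute sum is bounded by the `L^∞`-operator norm. -/
theorem klcr_row_sum_le_norm (A : Matrix S S ℂ) (i : S) : ∑ j, ‖A i j‖ ≤ ‖A‖ := by
  rw [Matrix.linfty_opNorm_def]
  have h := Finset.le_sup (f := fun i : S => ∑ j : S, ‖A i j‖₊) (Finset.mem_univ i)
  have h' : ((∑ j : S, ‖A i j‖₊ : NNReal) : ℝ) ≤ ((Finset.univ.sup fun i : S => ∑ j : S, ‖A i j‖₊ : NNReal) : ℝ) :=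
    NNReal.coe_le_coe.mpr h
  simpa using h'

/-- An entry is bounded by the `L^∞`-operator norm. -/
theorem klcr_entry_le_norm (A : Matrix S S ℂ) (i j : S) : ‖A i j‖ ≤ ‖A‖ :=
  le_trans (Finset.single_le_sum (f := fun j => ‖A i j‖) (fun _ _ => norm_nonneg _) (Finset.mem_univ j))
    (klcr_row_sum_le_norm A i)

/-- Row-wise bounds give a bound on the `L^∞`-operator norm. -/
theorem klcr_norm_le_of_rows (A : Matrix S S ℂ) {c : ℝ} (hc : 0 ≤ c) (h : ∀ i, ∑ j, ‖A i j‖ ≤ c) : ‖A‖ ≤ c := by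
  rw [Matrix.linfty_opNorm_def]
  have hsup : (Finset.univ.sup fun i : S => ∑ j : S, ‖A i j‖₊) ≤ c.toNNReal := by
    refine Finset.sup_le fun i _ => ?_
    rw [← NNReal.coe_le_coe, Real.coe_toNNReal _ hc, NNReal.coe_sum]
    simpa only [coe_nnnorm] using h i
  calc ((Finset.univ.sup fun i : S => ∑ j : S, ‖A i j‖₊ : NNReal) : ℝ) ≤ (c.toNNReal : ℝ) := NNReal.coe_le_coe.mpr hsup
    _ = c := Real.coe_toNNReal _ hc

/-- Entries of a product: `|(A C)_{ij}| ≤ ‖A‖ · max_k |C_{kj}|`. -/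
theorem klcr_mul_entry_le (A C : Matrix S S ℂ) {m : ℝ} (hm : 0 ≤ m) (j : S) (hC : ∀ k, ‖C k j‖ ≤ m) (i : S) :
    ‖(A * C) i j‖ ≤ ‖A‖ * m := by
  rw [Matrix.mul_apply]
  calc ‖∑ k, A i k * C k j‖ ≤ ∑ k, ‖A i k * C k j‖ := norm_sum_le _ _
    _ ≤ ∑ k, ‖A i k‖ * m := sum_le_sum fun k _ => by rw [norm_mul]; exact mul_le_mul_of_nonneg_left (hC k) (norm_nonneg _)
    _ = (∑ k, ‖A i k‖) * m := by rw [Finset.sum_mul]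
    _ ≤ ‖A‖ * m := mul_le_mul_of_nonneg_right (klcr_row_sum_le_norm A i) hm

/-- Entries of `A *ᵥ v`: `|(A v)_i| ≤ ‖A‖ · max |v|`. -/
theorem klcr_mulVec_entry_le (A : Matrix S S ℂ) (v : S → ℂ) {m : ℝ} (hm : 0 ≤ m) (hv : ∀ k, ‖v k‖ ≤ m) (i : S) :
    ‖(A *ᵥ v) i‖ ≤ ‖A‖ * m := by
  rw [Matrix.mulVec, dotProduct]
  calc ‖∑ k, A i k * v k‖ ≤ ∑ k, ‖A i k * v k‖ := norm_sum_le _ _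
    _ ≤ ∑ k, ‖A i k‖ * m := sum_le_sum fun k _ => by rw [norm_mul]; exact mul_le_mul_of_nonneg_left (hv k) (norm_nonneg _)
    _ = (∑ k, ‖A i k‖) * m := by rw [Finset.sum_mul]
    _ ≤ ‖A‖ * m := mul_le_mul_of_nonneg_right (klcr_row_sum_le_norm A i) hm

omit [DecidableEq S] in
/-- Entries of `v ᵥ* C` for a weight vector: `|(v C)_j| ≤ (Σ_i |v_i|) · max_i |C_{ij}|`. -/
theorem klcr_vecMul_entry_le (v : S → ℂ) (C : Matrix S S ℂ) {m : ℝ} (j : S) (hC : ∀ i, ‖C i j‖ ≤ m) :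
    ‖(v ᵥ* C) j‖ ≤ (∑ i, ‖v i‖) * m := by
  rw [Matrix.vecMul, dotProduct]
  calc ‖∑ i, v i * C i j‖ ≤ ∑ i, ‖v i * C i j‖ := norm_sum_le _ _
    _ ≤ ∑ i, ‖v i‖ * m := sum_le_sum fun i _ => by rw [norm_mul]; exact mul_le_mul_of_nonneg_left (hC i) (norm_nonneg _)
    _ = (∑ i, ‖v i‖) * m := by rw [Finset.sum_mul]

/-! ### The Neumann part: `‖B·𝒟·diag w‖ ≤ B·W·δ` and the inverse of `1 + B·𝒟·diag w` -/

/-- Row sums of `B·𝒟·diag w`: `‖B·𝒟·diag w‖ ≤ B·W·δ`. -/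
theorem klcr_norm_smul_mul_diagonal_le (w : S → ℝ) (hw : ∀ s, 0 ≤ w s) {B δ : ℝ} (hB : 0 ≤ B) (hδ : 0 ≤ δ)
    (𝒟 : Matrix S S ℂ) (h𝒟 : ∀ s t, ‖𝒟 s t‖ ≤ δ) :
    ‖(B : ℂ) • (𝒟 * Matrix.diagonal (fun s => (w s : ℂ)))‖ ≤ B * (∑ s, w s) * δ := by
  rw [norm_smul, Complex.norm_real, Real.norm_eq_abs, abs_of_nonneg hB, mul_assoc]
  refine mul_le_mul_of_nonneg_left ?_ hB
  refine klcr_norm_le_of_rows _ (mul_nonneg (sum_nonneg fun s _ => hw s) hδ) fun i => ?_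
  calc ∑ j, ‖(𝒟 * Matrix.diagonal (fun s => (w s : ℂ))) i j‖ = ∑ j, ‖𝒟 i j‖ * w j := by
        refine sum_congr rfl fun j _ => ?_
        rw [Matrix.mul_diagonal, norm_mul, Complex.norm_real, Real.norm_eq_abs, abs_of_nonneg (hw j)]
    _ ≤ ∑ j, δ * w j := sum_le_sum fun j _ => mul_le_mul_of_nonneg_right (h𝒟 i j) (hw j)
    _ = (∑ s, w s) * δ := by rw [← Finset.mul_sum, mul_comm]

variable [Nonempty S]

/-- **Neumann.**  If `‖X‖ ≤ 1/3` then `1 + X` has a two-sided inverse `N` with `‖N‖ ≤ 3/2` and `‖N - 1‖ ≤ 1/2`. -/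
theorem klcr_neumann (X : Matrix S S ℂ) (hX : ‖X‖ ≤ 1 / 3) :
    ∃ N : Matrix S S ℂ, (1 + X) * N = 1 ∧ N * (1 + X) = 1 ∧ ‖N‖ ≤ 3 / 2 ∧ ‖N - 1‖ ≤ 1 / 2 := by
  have hX' : ‖-X‖ < 1 := by rw [norm_neg]; linarith
  haveI : CompleteSpace (Matrix S S ℂ) := inferInstance
  let u := Units.oneSub (-X) hX'
  set N : Matrix S S ℂ := ((u⁻¹ : (Matrix S S ℂ)ˣ) : Matrix S S ℂ) with hN_def
  have hval : (u : Matrix S S ℂ) = 1 + X := by simp [u]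
  have h1 : (1 + X) * N = 1 := by rw [← hval, hN_def]; exact u.mul_inv
  have h2 : N * (1 + X) = 1 := by rw [← hval, hN_def]; exact u.inv_mul
  have hNn : ‖N‖ ≤ 3 / 2 := by
    have h := tsum_geometric_le_of_norm_lt_one (-X) hX'
    have hinv : N = ∑' n : ℕ, (-X) ^ n := rfl
    rw [hinv]
    refine h.trans ?_
    rw [norm_one, norm_neg]
    have h3 : (1 - ‖X‖)⁻¹ ≤ 3 / 2 := by
      rw [inv_le_comm₀ (by linarith) (by norm_num)]
      linarith
    linarith
  refine ⟨N, h1, h2, hNn, ?_⟩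
  -- `N - 1 = -(X N)`
  have hid : N - 1 = -(X * N) := by
    have h1' : N + X * N = 1 := by rw [add_mul, one_mul] at h1; exact h1
    calc N - 1 = N - (N + X * N) := by rw [h1']
      _ = -(X * N) := by abel
  rw [hid, norm_neg]
  calc ‖X * N‖ ≤ ‖X‖ * ‖N‖ := norm_mul_le _ _
    _ ≤ (1 / 3) * (3 / 2) := mul_le_mul hX hNn (norm_nonneg _) (by norm_num)
    _ = 1 / 2 := by norm_num

/-! ### The Sherman–Morrison step and the entrywise bound -/

/-- **The sign-resolved Cooper resummation is entrywise bounded (child 1's core estimate for the leaf).**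
For weights `w ≥ 0` with `W = Σ w`, a repulsive s-wave coupling `U ≥ 0`, an accumulated bubble mass `B ≥ 0` and a second-order
array `𝒟` with `|𝒟(s,t)| ≤ δ` and `B·W·δ ≤ 1/3`: the matrix `1 + B·(U·J + 𝒟)·diag w` is invertible and every entry of the
resummed array `(1 + B·(U·J + 𝒟)·diag w)⁻¹·(U·J + 𝒟)` has modulus at most `6·(U + δ)` — uniformly in `B`. -/
theorem klcr_resummed_entry_le (w : S → ℝ) (hw : ∀ s, 0 ≤ w s) {U B δ : ℝ} (hU : 0 ≤ U) (hB : 0 ≤ B) (hδ : 0 ≤ δ)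
    (𝒟 : Matrix S S ℂ) (h𝒟 : ∀ s t, ‖𝒟 s t‖ ≤ δ) (hθ : B * (∑ s, w s) * δ ≤ 1 / 3) :
    IsUnit (1 + (B : ℂ) • ((Matrix.of (fun _ _ : S => (U : ℂ)) + 𝒟) * Matrix.diagonal (fun s => (w s : ℂ)))) ∧
    ∀ s t : S,
      ‖((1 + (B : ℂ) • ((Matrix.of (fun _ _ : S => (U : ℂ)) + 𝒟) * Matrix.diagonal (fun s => (w s : ℂ))))⁻¹ *
          (Matrix.of (fun _ _ : S => (U : ℂ)) + 𝒟)) s t‖ ≤ 6 * (U + δ) := by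
  -- notation
  set W : ℝ := ∑ s, w s with hW_def
  have hW : 0 ≤ W := sum_nonneg fun s _ => hw s
  set wC : S → ℂ := fun s => (w s : ℂ) with hwC_def
  set one : S → ℂ := fun _ => (1 : ℂ) with hone_def
  set Dw : Matrix S S ℂ := Matrix.diagonal wC with hDw_def
  set J : Matrix S S ℂ := Matrix.of (fun _ _ : S => (U : ℂ)) with hJ_def
  set 𝒞 : Matrix S S ℂ := J + 𝒟 with h𝒞_def
  set X : Matrix S S ℂ := (B : ℂ) • (𝒟 * Dw) with hX_def
  -- entry bound of `𝒞`
  have h𝒞 : ∀ s t, ‖𝒞 s t‖ ≤ U + δ := by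
    intro s t
    simp only [h𝒞_def, hJ_def, Matrix.add_apply, Matrix.of_apply]
    calc ‖(U : ℂ) + 𝒟 s t‖ ≤ ‖(U : ℂ)‖ + ‖𝒟 s t‖ := norm_add_le _ _
      _ ≤ U + δ := by rw [Complex.norm_real, Real.norm_eq_abs, abs_of_nonneg hU]; linarith [h𝒟 s t]
  have hUδ : 0 ≤ U + δ := add_nonneg hU hδ
  -- Neumann for `X`
  have hXn : ‖X‖ ≤ 1 / 3 := (klcr_norm_smul_mul_diagonal_le w hw hB hδ 𝒟 h𝒟).trans hθ
  obtain ⟨N, hN1, hN2, hNn, hNm1⟩ := klcr_neumann X hXn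
  -- `J * Dw = |𝟙⟩⟨w|` and the factorisation `T = (1 + X) + B U |𝟙⟩⟨w|`
  have hJDw : J * Dw = (U : ℂ) • Matrix.vecMulVec one wC := by
    ext s t
    simp [hJ_def, hDw_def, Matrix.mul_diagonal, Matrix.vecMulVec_apply, hone_def]
  set T : Matrix S S ℂ := 1 + (B : ℂ) • (𝒞 * Dw) with hT_def
  have hT : T = (1 + X) + ((B : ℂ) * U) • Matrix.vecMulVec one wC := by
    simp only [hT_def, h𝒞_def, hX_def, add_mul, hJDw, smul_add, smul_smul]
    abel
  -- the Sherman–Morrison vector `a = B U · N 𝟙` and denominator `d = 1 + ⟨w, a⟩`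
  set m : S → ℂ := N *ᵥ one with hm_def
  have hm_bound : ∀ s, ‖m s‖ ≤ 3 / 2 := fun s =>
    (klcr_mulVec_entry_le N one zero_le_one (fun k => by simp [hone_def]) s).trans (by linarith)
  have hm_re : ∀ s, 1 / 2 ≤ (m s).re := by
    intro s
    have hsplit : m s = 1 + ((N - 1) *ᵥ one) s := by
      simp only [hm_def, Matrix.sub_mulVec, Matrix.one_mulVec, Pi.sub_apply, hone_def]
      ring
    have hsmall : ‖((N - 1) *ᵥ one) s‖ ≤ 1 / 2 :=
      (klcr_mulVec_entry_le (N - 1) one zero_le_one (fun k => by simp [hone_def]) s).trans (by linarith)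
    rw [hsplit, Complex.add_re, Complex.one_re]
    have := (Complex.abs_re_le_norm (((N - 1) *ᵥ one) s)).trans hsmall
    rw [abs_le] at this
    linarith [this.1]
  set a : S → ℂ := ((B : ℂ) * U) • m with ha_def
  have ha_bound : ∀ s, ‖a s‖ ≤ B * U * (3 / 2) := by
    intro s
    simp only [ha_def, Pi.smul_apply, smul_eq_mul, norm_mul, Complex.norm_real, Real.norm_eq_abs, abs_of_nonneg hB,
      abs_of_nonneg hU]
    exact mul_le_mul_of_nonneg_left (hm_bound s) (mul_nonneg hB hU)
  set d : ℂ := 1 + wC ⬝ᵥ a with hd_def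
  have hd_re : 1 + B * U * W / 2 ≤ d.re := by
    have hsum : (wC ⬝ᵥ a).re = ∑ s, B * U * (w s * (m s).re) := by
      simp only [dotProduct, Complex.re_sum, hwC_def, ha_def, Pi.smul_apply, smul_eq_mul]
      refine sum_congr rfl fun s _ => ?_
      have : ((w s : ℂ) * ((B : ℂ) * U * m s)).re = B * U * (w s * (m s).re) := by
        simp [Complex.mul_re, Complex.ofReal_re, Complex.ofReal_im]
        ring
      exact this
    rw [hd_def, Complex.add_re, Complex.one_re, hsum, ← Finset.mul_sum]
    have : W / 2 ≤ ∑ s, w s * (m s).re := by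
      rw [hW_def, Finset.sum_div]
      exact sum_le_sum fun s _ => by
        have := mul_le_mul_of_nonneg_left (hm_re s) (hw s)
        linarith
    nlinarith [mul_nonneg hB hU]
  have hd_norm : 1 + B * U * W / 2 ≤ ‖d‖ := hd_re.trans (Complex.re_le_norm d)
  have hd_pos : 0 < ‖d‖ := lt_of_lt_of_le (by nlinarith [mul_nonneg (mul_nonneg hB hU) hW]) hd_norm
  have hd_ne : d ≠ 0 := norm_pos_iff.mp hd_pos
  -- the right inverse `R = (1 - d⁻¹ |a⟩⟨w|) N`
  set V : Matrix S S ℂ := Matrix.vecMulVec a wC with hV_def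
  set R : Matrix S S ℂ := (1 - d⁻¹ • V) * N with hR_def
  have hNa : (1 + X) *ᵥ a = ((B : ℂ) * U) • one := by
    simp only [ha_def, Matrix.mulVec_smul, hm_def, Matrix.mulVec_mulVec, hN1, Matrix.one_mulVec]
  have hfac : T = (1 + X) * (1 + V) := by
    rw [mul_add, mul_one, hV_def, Matrix.mul_vecMulVec, hNa, hT]
    congr 1
    ext s t
    simp [Matrix.vecMulVec_apply, hone_def]
  have hVV : V * V = (wC ⬝ᵥ a) • V := by
    rw [hV_def, Matrix.vecMulVec_mul_vecMulVec, Matrix.vecMulVec_smul]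
  have hSM : (1 + V) * (1 - d⁻¹ • V) = 1 := by
    calc (1 + V) * (1 - d⁻¹ • V) = (1 + V) - d⁻¹ • ((1 + V) * V) := by rw [mul_sub, mul_one, mul_smul_comm]
      _ = (1 + V) - d⁻¹ • ((1 + wC ⬝ᵥ a) • V) := by rw [add_mul, one_mul, hVV, add_smul, one_smul]
      _ = (1 + V) - (d⁻¹ * d) • V := by rw [smul_smul, hd_def]
      _ = 1 := by rw [inv_mul_cancel₀ hd_ne, one_smul, add_sub_cancel_right]
  have hTR : T * R = 1 := by
    rw [hfac, hR_def, ← mul_assoc, mul_assoc (1 + X), hSM, mul_one, hN1]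
  have hTunit : IsUnit T := by
    rw [Matrix.isUnit_iff_isUnit_det]
    exact Matrix.isUnit_det_of_right_inverse hTR
  have hTinv : T⁻¹ = R := Matrix.inv_eq_right_inv hTR
  refine ⟨hTunit, fun s t => ?_⟩
  -- the resummed array `T⁻¹ 𝒞 = N 𝒞 - d⁻¹ |a⟩⟨w| N 𝒞`
  have hY : T⁻¹ * 𝒞 = N * 𝒞 - d⁻¹ • Matrix.vecMulVec a (wC ᵥ* (N * 𝒞)) := by
    rw [hTinv, hR_def, mul_assoc, sub_mul, one_mul, Matrix.smul_mul, hV_def, Matrix.vecMulVec_mul]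
  have hNC : ∀ u t, ‖(N * 𝒞) u t‖ ≤ 3 / 2 * (U + δ) := fun u t =>
    (klcr_mul_entry_le N 𝒞 hUδ t (fun k => h𝒞 k t) u).trans (mul_le_mul_of_nonneg_right hNn hUδ)
  have hwNC : ∀ t, ‖(wC ᵥ* (N * 𝒞)) t‖ ≤ W * (3 / 2 * (U + δ)) := by
    intro t
    refine (klcr_vecMul_entry_le wC (N * 𝒞) t (fun i => hNC i t)).trans (le_of_eq ?_)
    congr 1
    rw [hW_def]
    exact sum_congr rfl fun i _ => by rw [hwC_def]; simp [abs_of_nonneg (hw i)]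
  rw [hY, Matrix.sub_apply, Matrix.smul_apply, Matrix.vecMulVec_apply, smul_eq_mul]
  calc ‖(N * 𝒞) s t - d⁻¹ * (a s * (wC ᵥ* (N * 𝒞)) t)‖
      ≤ ‖(N * 𝒞) s t‖ + ‖d⁻¹ * (a s * (wC ᵥ* (N * 𝒞)) t)‖ := norm_sub_le _ _
    _ ≤ 3 / 2 * (U + δ) + ‖d‖⁻¹ * ((B * U * (3 / 2)) * (W * (3 / 2 * (U + δ)))) := by
        refine add_le_add (hNC s t) ?_
        rw [norm_mul, norm_mul, norm_inv]
        exact mul_le_mul_of_nonneg_left (mul_le_mul (ha_bound s) (hwNC t) (norm_nonneg _) (by positivity))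
          (inv_nonneg.mpr (norm_nonneg _))
    _ ≤ 3 / 2 * (U + δ) + 9 / 2 * (U + δ) := by
        refine add_le_add le_rfl ?_
        -- `‖d‖⁻¹ · B U W ≤ 2` since `‖d‖ ≥ 1 + B U W / 2`
        have hkey : ‖d‖⁻¹ * (B * U * W) ≤ 2 := by
          rw [inv_mul_le_iff₀ hd_pos]
          nlinarith [hd_norm, mul_nonneg (mul_nonneg hB hU) hW]
        have : ‖d‖⁻¹ * ((B * U * (3 / 2)) * (W * (3 / 2 * (U + δ)))) = (‖d‖⁻¹ * (B * U * W)) * (9 / 4 * (U + δ)) := by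
          ring
        rw [this]
        nlinarith [hkey, hUδ, mul_nonneg (inv_nonneg.mpr (norm_nonneg d)) (mul_nonneg (mul_nonneg hB hU) hW)]
    _ = 6 * (U + δ) := by ring

end Summit.HubbardSuperconductivity.HubbardSuperconductivity.Theorems.KLProgrammeCooperResummation

end
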